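import Mathlib
import Literature.NumberTheory.LFunctions.NumHelpers
import Summits.QuantumFields.BalabanUV.Beta.EriceRemainderEnclosureHistoryAutonomyComparisonAgeCompositionStaticChainBandsUpper
import Summits.QuantumFields.BalabanUV.Beta.EriceRemainderEnclosureHistoryAutonomyComparisonAgeCompositionStaticChainBandsE
import Summits.QuantumFields.BalabanUV.Beta.EriceRemainderEnclosureHistoryAutonomyComparisonAgeCompositionStaticChainBandsF

/-!
# EriceRemainderEnclosureHistoryAutonomyComparisonAgeCompositionStaticChainBandsLower — (E79t) THE OBSERVER STEP ABOVE EVERY PAIR WITH `1∕8 ≤ z∕y ≤ 3∕10`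
# (`q ∈ [3.33, 8]`), `y ≥ 24`, from the seven half-constant packages (E79r∕s); and, with (E79p), ABOVE EVERY PAIR WITH `y∕8 ≤ z ≤ y − 1`, `y ≥ 24`

Cell `pub-balaban`, β-function sub-cell, BINDER row D4 «RemainderConst leaves for Bałaban's split» (`HOME/BINDER-OWNERS.md`; owner lineage `b2b-balaban-beta-an4`;
this file by co-owner #2 lineage `b2b-balaban-beta-d4-p2`, generation 70), β-FLOW TEAM duty (1), FREEZE (0) honoured (def-free; imports (E79p) `…BandsUpper`, (E79q)
`…BandStepLatticeHalf` (`band_pair_step_lattice_half`), (E79r∕s) `…BandsE∕F` (the seven half-constant packages), (E79n) `…BandsMid` (`thetabar_le_band`); nothing restated).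

HONEST FRAMING (page 1, verbatim and binding).  *"Discharging BetaPertH makes Bałaban's UV stability UNCONDITIONAL — a real constructive-QFT result; it is
NOT the continuum limit and NOT the Clay problem."*  THIS FILE DISCHARGES NOTHING OF THE KIND.  Case analysis on a rational ratio plus tree theorems —
hypotheses of a census, not facts; the age profile of Bałaban's (1.22) limit functional is NOT PRINTED ([I] p. 298; GAPS G-t4-U2-1∕-2) and NOT asserted.  Row D4
class UNCHANGED (critical-path width 0; instance 0∕1; D4 DISCHARGE NO DATE).  HONEST DEPENDENCY: continuum YM on T⁴ ⇐ BetaPertH ∧ nine spine estimates (0/9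
proved); BetaPertH ⇐ (D1) ∧ (D4) ∧ CAP+tail; G-an2-4 gates asym, D1 and NE2/3/4.

THE POINT (census sense (α); route (N′); README `HOME/b2b-balaban-beta-d4-p2/g70/e79/README.md` §4).  §1 `band_step_lattice_lower`: the range `y∕8 ≤ z ≤ 3y∕10`
(`q ∈ [3.33, 8]`), `y ≥ 24`, from the seven HALF-constant packages of (E79r∕s) (with the covariance constant 1 no band below `r = 1∕5` closes — README §4 table).
§2 **`band_step_lattice_ge_eighth`**: with (E79p), THE OBSERVER STEP (◆) ABOVE EVERY PAIR WITH `y∕8 ≤ z ≤ y−1`, `y ≥ 24`, every configuration, every admissible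
load, natural defect hypothesis `θ ≤ θ̄(y∕z)` — together with (E79g) (every adjacent pair) the current extent of the proved step inequality.  WHAT REMAINS:
`q > 8` (far template — per pair the certificate closes up to `q = 4096` with constant ½, but band envelopes inflate the spread product; bands of width 5 % in `r`
would do with ½, width 10 % needs the Grüss constant ¼, and the region is unbounded: a `√q`-scaled symbolic far lemma is the real item), the finitely many pairs
below the thresholds, the assembly.  NOT CLAIMED: those; the static closure; anything about the flow; printed.

WHAT IS PROVED ([folklore]; 0 `def`, 0 sorry).  §1 `band_step_lattice_lower`.  §2 **`band_step_lattice_ge_eighth`**.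
-/
noncomputable section
open Finset

namespace Summit.QuantumFields.BalabanUV.Beta.EriceRemainderEnclosureHistoryAutonomyComparisonAgeCompositionStaticChainBandsLower

open Summit.QuantumFields.BalabanUV.Beta.EriceRemainderEnclosureHistoryAutonomyComparisonAgeCompositionStaticChainBandStepLatticeHalf
open Summit.QuantumFields.BalabanUV.Beta.EriceRemainderEnclosureHistoryAutonomyComparisonAgeCompositionStaticChainBandsMid
open Summit.QuantumFields.BalabanUV.Beta.EriceRemainderEnclosureHistoryAutonomyComparisonAgeCompositionStaticChainBandsUpper
open Summit.QuantumFields.BalabanUV.Beta.EriceRemainderEnclosureHistoryAutonomyComparisonAgeCompositionStaticChainBandsE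
open Summit.QuantumFields.BalabanUV.Beta.EriceRemainderEnclosureHistoryAutonomyComparisonAgeCompositionStaticChainBandsF
open Literature.NumberTheory.LFunctions.VdC.Num (le_sqrt_of_sq_le)

/-! ## §1 The lower range `1∕8 ≤ z∕y ≤ 3∕10` -/

/-- **THE OBSERVER STEP (◆) ABOVE EVERY PAIR WITH `y∕8 ≤ z ≤ 3y∕10`, `y ≥ 24`**, every level-coupled configuration, every admissible load (`κ = 31∕40`; defect
hypothesis `θ ≤ θ̄(y∕z)`): the seven packages of (E79r∕s) through (E79q) `band_pair_step_lattice_half`; defect constants by (E79n) `thetabar_le_band`. [folklore] -/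
theorem band_step_lattice_lower {n y z : ℕ} {k : ℕ → ℕ} {x a cy cz Sy Sz Ry Rz : ℕ → ℝ} {θ xy Ψyy Ψyz Ψzy Ψzz Ωz σ φ s : ℝ}
    (hy : 24 ≤ y) (hlo : (1/8:ℝ) * y ≤ z) (hhi : (z : ℝ) ≤ (3/10:ℝ) * y)
    (hn : 0 < n) (hk : ∀ l, l < n → y + 1 ≤ k l) (hx : ∀ l, l < n → 0 ≤ x l)
    (hSy : ∀ l, l < n → Sy l = ∑ m ∈ range y, Real.sqrt ((k l : ℝ) / ((k l : ℝ) + m + 1)))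
    (hSz : ∀ l, l < n → Sz l = ∑ m ∈ range z, Real.sqrt ((k l : ℝ) / ((k l : ℝ) + m + 1)))
    (hRy : ∀ l, l < n → Ry l = ∑ m ∈ range (k l), Real.sqrt ((y : ℝ) / ((y : ℝ) + m + 1)))
    (hRz : ∀ l, l < n → Rz l = ∑ m ∈ range (k l), Real.sqrt ((z : ℝ) / ((z : ℝ) + m + 1)))
    (ha0 : ∀ i, i < n → 0 < a i)
    (ha : ∀ i, i < n → a i = 1 + ∑ l ∈ range n,
      (2 * x l * (∑ m ∈ range (k i), Real.sqrt ((k l : ℝ) / ((k l : ℝ) + m + 1))) / k l) * a l)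
    (hcy : ∀ i, i < n → cy i = Ry i / (y : ℝ) + ∑ l ∈ range n,
      (2 * x l * (∑ m ∈ range (k i), Real.sqrt ((k l : ℝ) / ((k l : ℝ) + m + 1))) / k l) * cy l)
    (hcz : ∀ i, i < n → cz i = Rz i / (z : ℝ) + ∑ l ∈ range n,
      (2 * x l * (∑ m ∈ range (k i), Real.sqrt ((k l : ℝ) / ((k l : ℝ) + m + 1))) / k l) * cz l)
    (hΨyy : Ψyy = ∑ l ∈ range n, (2 * x l * Sy l / k l) * cy l) (hΨyz : Ψyz = ∑ l ∈ range n, (2 * x l * Sz l / k l) * cy l)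
    (hΨzy : Ψzy = ∑ l ∈ range n, (2 * x l * Sy l / k l) * cz l) (hΨzz : Ψzz = ∑ l ∈ range n, (2 * x l * Sz l / k l) * cz l)
    (hΩz : Ωz = ∑ l ∈ range n, x l * (z : ℝ) / k l)
    (hσ : σ = (∑ m ∈ range z, Real.sqrt ((y : ℝ) / ((y : ℝ) + m + 1))) / (y : ℝ))
    (hφ : φ = (∑ m ∈ range y, Real.sqrt ((z : ℝ) / ((z : ℝ) + m + 1))) / (z : ℝ))
    (hs : s = (∑ m ∈ range y, Real.sqrt ((y : ℝ) / ((y : ℝ) + m + 1))) / (y : ℝ))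
    (hθ : θ ≤ 1 - ((y : ℝ) / z) / ((y : ℝ) / z + 1) * Real.sqrt (((y : ℝ) / z) / ((y : ℝ) / z + 1)) * Real.exp (-(1 / (2 * ((y : ℝ) / z)))))
    (hxy : 0 ≤ xy) (hcap : 2 * xy * (s + Ψyy) < 1) :
    (1 + 2 * (31/40:ℝ) * Ψzz) * (1 - Ωz) - (1 - θ) * (xy * (1 + 2 * (31/40:ℝ) * Ψyy))
      ≤ (1 - xy * (1 + 2 * (31/40:ℝ) * Ψyy)) *
        ((1 + 2 * (31/40:ℝ) * Ψzz + 4 * (31/40:ℝ) * xy * ((σ + Ψyz) * (φ + Ψzy)) / (1 - 2 * (s + Ψyy) * xy)) * ((1 - Ωz) - xy / ((y : ℝ) / (z : ℝ)))) := by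
  have hy' : (24 : ℝ) ≤ y := by exact_mod_cast hy
  have hz1 : 1 ≤ z := by
    by_contra h
    have : (z : ℝ) ≤ 0 := by exact_mod_cast (show z ≤ 0 by omega)
    linarith
  have hzp : (0 : ℝ) < z := by exact_mod_cast (show 0 < z by omega)
  have hzy : z + 1 ≤ y := by
    have : (z : ℝ) + 1 ≤ y := by linarith
    exact_mod_cast this
  by_cases c0 : (z : ℝ) ≤ (3/20:ℝ) * y
  · have hzlo : 3 ≤ z := by
      by_contra h
      have : (z : ℝ) ≤ 2 := by exact_mod_cast (show z ≤ 2 by omega)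
      linarith [show (1/8:ℝ) * (y : ℝ) ≤ z from hlo]
    exact band_pair_step_lattice_half (rl := (1/8:ℝ)) (rh := (3/20:ℝ)) (y0 := 24) (z0 := 3) (th := (1/4:ℝ)) (by norm_num) (by norm_num) (by omega) hzlo hz1 hzy hlo c0 facts_band_1_8_to_3_20
      hn hk hx hSy hSz hRy hRz ha0 ha hcy hcz hΨyy hΨyz hΨzy hΨzz hΩz hσ hφ hs
      (hθ.trans (thetabar_le_band (ql := (20/3:ℝ)) (Lc := (116563/125000:ℝ)) (by norm_num) (by rw [le_div_iff₀ hzp]; linarith) (le_sqrt_of_sq_le (by norm_num) (by norm_num)) (by norm_num) (by norm_num))) hxy hcap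
  by_cases c1 : (z : ℝ) ≤ (7/40:ℝ) * y
  · have hzlo : 2 ≤ z := by
      by_contra h
      have : (z : ℝ) ≤ 1 := by exact_mod_cast (show z ≤ 1 by omega)
      linarith [show (3/20:ℝ) * (y : ℝ) ≤ z from (not_le.mp c0).le]
    exact band_pair_step_lattice_half (rl := (3/20:ℝ)) (rh := (7/40:ℝ)) (y0 := 12) (z0 := 2) (th := (709/2500:ℝ)) (by norm_num) (by norm_num) (by omega) hzlo hz1 hzy (not_le.mp c0).le c1 facts_band_3_20_to_7_40
      hn hk hx hSy hSz hRy hRz ha0 ha hcy hcz hΨyy hΨyz hΨzy hΨzz hΩz hσ hφ hs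
      (hθ.trans (thetabar_le_band (ql := (40/7:ℝ)) (Lc := (922531/1000000:ℝ)) (by norm_num) (by rw [le_div_iff₀ hzp]; linarith) (le_sqrt_of_sq_le (by norm_num) (by norm_num)) (by norm_num) (by norm_num))) hxy hcap
  by_cases c2 : (z : ℝ) ≤ (1/5:ℝ) * y
  · have hzlo : 2 ≤ z := by
      by_contra h
      have : (z : ℝ) ≤ 1 := by exact_mod_cast (show z ≤ 1 by omega)
      linarith [show (7/40:ℝ) * (y : ℝ) ≤ z from (not_le.mp c1).le]
    exact band_pair_step_lattice_half (rl := (7/40:ℝ)) (rh := (1/5:ℝ)) (y0 := 8) (z0 := 2) (th := (1577/5000:ℝ)) (by norm_num) (by norm_num) (by omega) hzlo hz1 hzy (not_le.mp c1).le c2 facts_band_7_40_to_1_5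
      hn hk hx hSy hSz hRy hRz ha0 ha hcy hcz hΨyy hΨyz hΨzy hΨzz hΩz hσ hφ hs
      (hθ.trans (thetabar_le_band (ql := (5:ℝ)) (Lc := (91287/100000:ℝ)) (by norm_num) (by rw [le_div_iff₀ hzp]; linarith) (le_sqrt_of_sq_le (by norm_num) (by norm_num)) (by norm_num) (by norm_num))) hxy hcap
  by_cases c3 : (z : ℝ) ≤ (9/40:ℝ) * y
  · have hzlo : 2 ≤ z := by
      by_contra h
      have : (z : ℝ) ≤ 1 := by exact_mod_cast (show z ≤ 1 by omega)
      linarith [show (1/5:ℝ) * (y : ℝ) ≤ z from (not_le.mp c2).le]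
    exact band_pair_step_lattice_half (rl := (1/5:ℝ)) (rh := (9/40:ℝ)) (y0 := 8) (z0 := 2) (th := (691/2000:ℝ)) (by norm_num) (by norm_num) (by omega) hzlo hz1 hzy (not_le.mp c2).le c3 facts_band_1_5_to_9_40
      hn hk hx hSy hSz hRy hRz ha0 ha hcy hcz hΨyy hΨyz hΨzy hΨzz hΩz hσ hφ hs
      (hθ.trans (thetabar_le_band (ql := (40/9:ℝ)) (Lc := (903507/1000000:ℝ)) (by norm_num) (by rw [le_div_iff₀ hzp]; linarith) (le_sqrt_of_sq_le (by norm_num) (by norm_num)) (by norm_num) (by norm_num))) hxy hcap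
  by_cases c4 : (z : ℝ) ≤ (1/4:ℝ) * y
  · have hzlo : 2 ≤ z := by
      by_contra h
      have : (z : ℝ) ≤ 1 := by exact_mod_cast (show z ≤ 1 by omega)
      linarith [show (9/40:ℝ) * (y : ℝ) ≤ z from (not_le.mp c3).le]
    exact band_pair_step_lattice_half (rl := (9/40:ℝ)) (rh := (1/4:ℝ)) (y0 := 8) (z0 := 2) (th := (187/500:ℝ)) (by norm_num) (by norm_num) (by omega) hzlo hz1 hzy (not_le.mp c3).le c4 facts_band_9_40_to_1_4
      hn hk hx hSy hSz hRy hRz ha0 ha hcy hcz hΨyy hΨyz hΨzy hΨzz hΩz hσ hφ hs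
      (hθ.trans (thetabar_le_band (ql := (4:ℝ)) (Lc := (894427/1000000:ℝ)) (by norm_num) (by rw [le_div_iff₀ hzp]; linarith) (le_sqrt_of_sq_le (by norm_num) (by norm_num)) (by norm_num) (by norm_num))) hxy hcap
  by_cases c5 : (z : ℝ) ≤ (11/40:ℝ) * y
  · have hzlo : 2 ≤ z := by
      by_contra h
      have : (z : ℝ) ≤ 1 := by exact_mod_cast (show z ≤ 1 by omega)
      linarith [show (1/4:ℝ) * (y : ℝ) ≤ z from (not_le.mp c4).le]
    exact band_pair_step_lattice_half (rl := (1/4:ℝ)) (rh := (11/40:ℝ)) (y0 := 8) (z0 := 2) (th := (401/1000:ℝ)) (by norm_num) (by norm_num) (by omega) hzlo hz1 hzy (not_le.mp c4).le c5 facts_band_1_4_to_11_40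
      hn hk hx hSy hSz hRy hRz ha0 ha hcy hcz hΨyy hΨyz hΨzy hΨzz hΩz hσ hφ hs
      (hθ.trans (thetabar_le_band (ql := (40/11:ℝ)) (Lc := (442807/500000:ℝ)) (by norm_num) (by rw [le_div_iff₀ hzp]; linarith) (le_sqrt_of_sq_le (by norm_num) (by norm_num)) (by norm_num) (by norm_num))) hxy hcap
  have hzlo : 3 ≤ z := by
    by_contra h
    have : (z : ℝ) ≤ 2 := by exact_mod_cast (show z ≤ 2 by omega)
    linarith [show (11/40:ℝ) * (y : ℝ) ≤ z from (not_le.mp c5).le]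
  exact band_pair_step_lattice_half (rl := (11/40:ℝ)) (rh := (3/10:ℝ)) (y0 := 8) (z0 := 3) (th := (2133/5000:ℝ)) (by norm_num) (by norm_num) (by omega) hzlo hz1 hzy (not_le.mp c5).le hhi facts_band_11_40_to_3_10
    hn hk hx hSy hSz hRy hRz ha0 ha hcy hcz hΨyy hΨyz hΨzy hΨzz hΩz hσ hφ hs
    (hθ.trans (thetabar_le_band (ql := (10/3:ℝ)) (Lc := (438529/500000:ℝ)) (by norm_num) (by rw [le_div_iff₀ hzp]; linarith) (le_sqrt_of_sq_le (by norm_num) (by norm_num)) (by norm_num) (by norm_num))) hxy hcap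

/-! ## §2 Every pair with `z ≥ y∕8` above the threshold -/

/-- **THE OBSERVER STEP (◆) ABOVE EVERY PAIR OF SCALES WITH `y∕8 ≤ z ≤ y − 1` AND `y ≥ 24`** — every scale ratio `1 < q = y∕z ≤ 8` above the threshold — for every
level-coupled configuration of older ages and every admissible load, natural defect hypothesis: §1 and (E79p) `band_step_lattice_ge_three_tenths`.  With (E79g)
(all adjacent pairs) this is the current extent of the proved step inequality of the observer induction. [folklore] -/
theorem band_step_lattice_ge_eighth {n y z : ℕ} {k : ℕ → ℕ} {x a cy cz Sy Sz Ry Rz : ℕ → ℝ} {θ xy Ψyy Ψyz Ψzy Ψzz Ωz σ φ s : ℝ}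
    (hy : 24 ≤ y) (hlo : (1/8:ℝ) * y ≤ z) (hzy : z + 1 ≤ y)
    (hn : 0 < n) (hk : ∀ l, l < n → y + 1 ≤ k l) (hx : ∀ l, l < n → 0 ≤ x l)
    (hSy : ∀ l, l < n → Sy l = ∑ m ∈ range y, Real.sqrt ((k l : ℝ) / ((k l : ℝ) + m + 1)))
    (hSz : ∀ l, l < n → Sz l = ∑ m ∈ range z, Real.sqrt ((k l : ℝ) / ((k l : ℝ) + m + 1)))
    (hRy : ∀ l, l < n → Ry l = ∑ m ∈ range (k l), Real.sqrt ((y : ℝ) / ((y : ℝ) + m + 1)))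
    (hRz : ∀ l, l < n → Rz l = ∑ m ∈ range (k l), Real.sqrt ((z : ℝ) / ((z : ℝ) + m + 1)))
    (ha0 : ∀ i, i < n → 0 < a i)
    (ha : ∀ i, i < n → a i = 1 + ∑ l ∈ range n,
      (2 * x l * (∑ m ∈ range (k i), Real.sqrt ((k l : ℝ) / ((k l : ℝ) + m + 1))) / k l) * a l)
    (hcy : ∀ i, i < n → cy i = Ry i / (y : ℝ) + ∑ l ∈ range n,
      (2 * x l * (∑ m ∈ range (k i), Real.sqrt ((k l : ℝ) / ((k l : ℝ) + m + 1))) / k l) * cy l)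
    (hcz : ∀ i, i < n → cz i = Rz i / (z : ℝ) + ∑ l ∈ range n,
      (2 * x l * (∑ m ∈ range (k i), Real.sqrt ((k l : ℝ) / ((k l : ℝ) + m + 1))) / k l) * cz l)
    (hΨyy : Ψyy = ∑ l ∈ range n, (2 * x l * Sy l / k l) * cy l) (hΨyz : Ψyz = ∑ l ∈ range n, (2 * x l * Sz l / k l) * cy l)
    (hΨzy : Ψzy = ∑ l ∈ range n, (2 * x l * Sy l / k l) * cz l) (hΨzz : Ψzz = ∑ l ∈ range n, (2 * x l * Sz l / k l) * cz l)
    (hΩz : Ωz = ∑ l ∈ range n, x l * (z : ℝ) / k l)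
    (hσ : σ = (∑ m ∈ range z, Real.sqrt ((y : ℝ) / ((y : ℝ) + m + 1))) / (y : ℝ))
    (hφ : φ = (∑ m ∈ range y, Real.sqrt ((z : ℝ) / ((z : ℝ) + m + 1))) / (z : ℝ))
    (hs : s = (∑ m ∈ range y, Real.sqrt ((y : ℝ) / ((y : ℝ) + m + 1))) / (y : ℝ))
    (hθ : θ ≤ 1 - ((y : ℝ) / z) / ((y : ℝ) / z + 1) * Real.sqrt (((y : ℝ) / z) / ((y : ℝ) / z + 1)) * Real.exp (-(1 / (2 * ((y : ℝ) / z)))))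
    (hxy : 0 ≤ xy) (hcap : 2 * xy * (s + Ψyy) < 1) :
    (1 + 2 * (31/40:ℝ) * Ψzz) * (1 - Ωz) - (1 - θ) * (xy * (1 + 2 * (31/40:ℝ) * Ψyy))
      ≤ (1 - xy * (1 + 2 * (31/40:ℝ) * Ψyy)) *
        ((1 + 2 * (31/40:ℝ) * Ψzz + 4 * (31/40:ℝ) * xy * ((σ + Ψyz) * (φ + Ψzy)) / (1 - 2 * (s + Ψyy) * xy)) * ((1 - Ωz) - xy / ((y : ℝ) / (z : ℝ)))) := by
  by_cases c : (z : ℝ) ≤ (3/10:ℝ) * y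
  · exact band_step_lattice_lower hy hlo c hn hk hx hSy hSz hRy hRz ha0 ha hcy hcz hΨyy hΨyz hΨzy hΨzz hΩz hσ hφ hs hθ hxy hcap
  · exact band_step_lattice_ge_three_tenths hy (not_le.mp c).le hzy hn hk hx hSy hSz hRy hRz ha0 ha hcy hcz hΨyy hΨyz hΨzy hΨzz hΩz hσ hφ hs hθ hxy hcap

end Summit.QuantumFields.BalabanUV.Beta.EriceRemainderEnclosureHistoryAutonomyComparisonAgeCompositionStaticChainBandsLower

end
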